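import Summits.QuantumFields.GaugeBoot.PeriodicWords
import Literature.RepresentationTheory.CompactGroups.UnitaryTrick
import HarnessLib

/-!
# Gauge-boot: the links read by a word on a periodic lattice `(A, e)`, and the holonomy when ONE link variable is replaced —
# the periodic / `ℤ^d` twin of `WordUpdate.lean` (large-`N` supplement 20, part 2)

HONEST FRAMING (cell `pub-gaugeboot`, page 1 of every file): certified bounds on lattice
expectations at STATED coupling, gauge group, dimension and torus size; NOT a mass gap, NOT a
continuum limit, NOT a string tension; NOT Yang–Mills-summit-bearing (barriers `FixedCouplingUltralocality`,
`PerturbativeInvisibility`).  Pure algebra of lattice words; no measure; it certifies no number.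

## Content

`WordUpdate.lean` (cell ym-instrument) is typed over the cubic torus.  Verbatim over the periodic word calculus of `PeriodicWords.lean`
(`A` any additive commutative group of sites, translations `e : Fin d → A`; the infinite lattice `(ℤ^d, zdUnit)` included):

* `TiltedRP.Word.edgesRead e x w` — the list of positively oriented links traversed by `w` read from `x` (in order, with multiplicity);
* `TiltedRP.wordHolonomy_update_of_not_mem` — a link not read by a word does not enter its holonomy;
* `TiltedRP.Word.Split e x w l` — `w = w₁ · s · w₂` with `s` reading the link `l` and `w₁`, `w₂` not; it exists iff
  `(edgesRead e x w).count l = 1` (`nonempty_split_of_count_eq_one`, `split`); then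
  `hol_x(w)(U[l ↦ h]) = A(U) · h^{±1} · B(U)` (`Split.wordHolonomy_update`) and, for a compact group with a continuous matrix
  representation, `Re tr ρ(hol_x(w)(U[l ↦ h])) = Re tr ρ(h · staple(U))` (`Split.re_trace_wordHolonomy_update`).
[folklore]
-/

namespace Summit.QuantumFields.GaugeBoot

namespace TiltedRP

variable {A : Type*} [AddCommGroup A] {d : ℕ} (e : Fin d → A)

namespace Word

/-! ## The links read by a word -/

/-- The list of positively oriented links traversed by the word `w` read from `x` on `(A, e)`, in order and with
multiplicity (`Step.link`). [folklore] -/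
def edgesRead : A → Word d → List (Link A d)
  | _, [] => []
  | x, s :: w => s.link e x :: edgesRead (s.move e x) w

/-- Unfolding lemma `edgesRead_nil`. [folklore] -/
@[simp] theorem edgesRead_nil (x : A) : edgesRead e x ([] : Word d) = [] := rfl

/-- Unfolding lemma `edgesRead_cons`. [folklore] -/
@[simp] theorem edgesRead_cons (x : A) (s : Step d) (w : Word d) :
    edgesRead e x (s :: w) = s.link e x :: edgesRead e (s.move e x) w := rfl

/-- The links read by a concatenation. [folklore] -/
theorem edgesRead_append (x : A) (v w : Word d) :
    edgesRead e x (v ++ w) = edgesRead e x v ++ edgesRead e (endpoint e x v) w := by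
  induction v generalizing x with
  | nil => rfl
  | cons s v ih => simp [ih]

/-- A word reads as many links as it has steps. [folklore] -/
@[simp] theorem length_edgesRead (x : A) (w : Word d) : (edgesRead e x w).length = w.length := by
  induction w generalizing x with
  | nil => rfl
  | cons s w ih => simp [ih]

end Word

/-! ## Holonomies with one link variable replaced -/

section Update

variable {G : Type*} [Group G]

/-- A step not reading the link `l` has the same holonomy after the link `l` is replaced. [folklore] -/
theorem stepHolonomy_update_of_ne [DecidableEq A] (U : Config A d G) (l : Link A d) (g : G) (x : A) (s : Step d)
    (h : s.link e x ≠ l) : stepHolonomy e (Function.update U l g) x s = stepHolonomy e U x s := by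
  rw [stepHolonomy_eq, stepHolonomy_eq, Function.update_of_ne h]

/-- The step reading the replaced link carries `g` (forward) or `g⁻¹` (backward). [folklore] -/
theorem stepHolonomy_update_self [DecidableEq A] (U : Config A d G) (g : G) (x : A) (s : Step d) :
    stepHolonomy e (Function.update U (s.link e x) g) x s = if s.isFwd then g else g⁻¹ := by
  rw [stepHolonomy_eq, Function.update_self]

/-- **A word not reading `l` has the same holonomy after the link `l` is replaced.** [folklore] -/
theorem wordHolonomy_update_of_not_mem [DecidableEq A] (U : Config A d G) (l : Link A d) (g : G) :
    ∀ (x : A) (w : Word d), l ∉ Word.edgesRead e x w →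
      wordHolonomy e (Function.update U l g) x w = wordHolonomy e U x w
  | x, [], _ => by simp
  | x, s :: w, h => by
    simp only [Word.edgesRead_cons, List.mem_cons, not_or] at h
    rw [wordHolonomy_cons, wordHolonomy_cons, stepHolonomy_update_of_ne e U l g x s (Ne.symm h.1),
      wordHolonomy_update_of_not_mem U l g (s.move e x) w h.2]

end Update

namespace Word

/-! ## Reading a link exactly once: the split `w = w₁ · s · w₂` -/

/-- A decomposition of the word `w` (read from `x` on `(A, e)`) as `w₁ ++ s :: w₂` in which the step `s` reads the link `l` and
neither `w₁` nor `w₂` does. [folklore] -/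
structure Split (x : A) (w : Word d) (l : Link A d) where
  /-- the prefix, not reading `l` -/
  pre : Word d
  /-- the step reading `l` -/
  step : Step d
  /-- the suffix, not reading `l` -/
  suf : Word d
  /-- the decomposition -/
  eq : w = pre ++ step :: suf
  /-- the prefix does not read `l` -/
  pre_not_mem : l ∉ edgesRead e x pre
  /-- the step reads `l` -/
  step_link : step.link e (endpoint e x pre) = l
  /-- the suffix does not read `l` -/
  suf_not_mem : l ∉ edgesRead e (step.move e (endpoint e x pre)) suf

/-- **A word reading the link `l` exactly once splits at that step.** [folklore] -/
theorem nonempty_split_of_count_eq_one [DecidableEq A] (l : Link A d) :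
    ∀ (x : A) (w : Word d), (edgesRead e x w).count l = 1 → Nonempty (Split e x w l)
  | x, [], h => by simp at h
  | x, s :: w, h => by
    rw [edgesRead_cons, List.count_cons] at h
    by_cases hs : s.link e x = l
    · have h0 : (edgesRead e (s.move e x) w).count l = 0 := by
        rw [hs, beq_self_eq_true, if_pos rfl] at h; omega
      exact ⟨{
        pre := []
        step := s
        suf := w
        eq := rfl
        pre_not_mem := by simp
        step_link := hs
        suf_not_mem := List.not_mem_of_count_eq_zero h0 }⟩
    · have h1 : (edgesRead e (s.move e x) w).count l = 1 := by
        have : (s.link e x == l) = false := beq_eq_false_iff_ne.mpr hs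
        rw [this] at h; simpa using h
      obtain ⟨S⟩ := nonempty_split_of_count_eq_one l (s.move e x) w h1
      have hpre : l ∉ edgesRead e x (s :: S.pre) := by
        simp only [edgesRead_cons, List.mem_cons, not_or]
        exact ⟨Ne.symm hs, S.pre_not_mem⟩
      exact ⟨{
        pre := s :: S.pre
        step := S.step
        suf := S.suf
        eq := by rw [List.cons_append]; exact congrArg (List.cons s) S.eq
        pre_not_mem := hpre
        step_link := by simpa using S.step_link
        suf_not_mem := by simpa using S.suf_not_mem }⟩

/-- A chosen split of a word reading `l` exactly once. [folklore] -/
noncomputable def split [DecidableEq A] (x : A) (w : Word d) (l : Link A d) (h : (edgesRead e x w).count l = 1) :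
    Split e x w l :=
  Classical.choice (nonempty_split_of_count_eq_one e l x w h)

namespace Split

variable {e} {x : A} {w : Word d} {l : Link A d} (S : Split e x w l)

/-- The links read by the whole word, through the split. [folklore] -/
theorem edgesRead_eq : edgesRead e x w = edgesRead e x S.pre ++ l :: edgesRead e (S.step.move e (endpoint e x S.pre)) S.suf := by
  conv_lhs => rw [S.eq]
  rw [edgesRead_append, edgesRead_cons, S.step_link]

variable {G : Type*} [Group G]

/-- The prefix holonomy `A(U) = hol_x(w₁)(U)`. [folklore] -/
def preHol (U : Config A d G) : G := wordHolonomy e U x S.pre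

/-- The suffix holonomy `B(U) = hol(w₂)(U)` read from the endpoint of the step. [folklore] -/
def sufHol (U : Config A d G) : G := wordHolonomy e U (S.step.move e (endpoint e x S.pre)) S.suf

/-- The prefix holonomy does not read `l`. [folklore] -/
theorem preHol_update [DecidableEq A] (U : Config A d G) (g : G) : S.preHol (Function.update U l g) = S.preHol U :=
  wordHolonomy_update_of_not_mem e U l g x S.pre S.pre_not_mem

/-- The suffix holonomy does not read `l`. [folklore] -/
theorem sufHol_update [DecidableEq A] (U : Config A d G) (g : G) : S.sufHol (Function.update U l g) = S.sufHol U :=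
  wordHolonomy_update_of_not_mem e U l g _ S.suf S.suf_not_mem

/-- The holonomy of the word factorises through the split: `hol_x(w) = A · hol(s) · B`. [folklore] -/
theorem wordHolonomy_eq (U : Config A d G) :
    wordHolonomy e U x w = S.preHol U * stepHolonomy e U (endpoint e x S.pre) S.step * S.sufHol U := by
  conv_lhs => rw [S.eq]
  rw [wordHolonomy_append, wordHolonomy_cons, mul_assoc]
  rfl

/-- **The word is affine in the once-read link**: `hol_x(w)(U[l ↦ g]) = A(U) · g^{±1} · B(U)`. [folklore] -/
theorem wordHolonomy_update [DecidableEq A] (U : Config A d G) (g : G) :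
    wordHolonomy e (Function.update U l g) x w = S.preHol U * (if S.step.isFwd then g else g⁻¹) * S.sufHol U := by
  rw [S.wordHolonomy_eq, S.preHol_update, S.sufHol_update]
  congr 2
  have h := stepHolonomy_update_self e U g (endpoint e x S.pre) S.step
  rw [S.step_link] at h
  exact h

/-- The STAPLE of the split: `B A` (forward reading) or `(B A)⁻¹` (backward reading). [folklore] -/
noncomputable def staple (U : Config A d G) : G :=
  if S.step.isFwd then S.sufHol U * S.preHol U else (S.sufHol U * S.preHol U)⁻¹

/-- The staple does not read `l`. [folklore] -/
theorem staple_update [DecidableEq A] (U : Config A d G) (g : G) : S.staple (Function.update U l g) = S.staple U := by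
  simp only [staple, S.preHol_update, S.sufHol_update]

variable {N : ℕ} [TopologicalSpace G] [IsTopologicalGroup G] [CompactSpace G] (ρ : G →* Matrix (Fin N) (Fin N) ℂ)

/-- **Trace form of the one-link dependence**: `Re tr ρ(hol_x(w)(U[l ↦ g])) = Re tr ρ(g · staple(U))` (compact group, continuous
matrix representation: cyclicity and `Re tr ρ(h⁻¹) = Re tr ρ(h)`). [folklore] -/
theorem re_trace_wordHolonomy_update [DecidableEq A] (hρ : Continuous ρ) (U : Config A d G) (g : G) :
    (ρ (wordHolonomy e (Function.update U l g) x w)).trace.re = (ρ (g * S.staple U)).trace.re := by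
  rw [S.wordHolonomy_update U g, staple]
  split_ifs with hf
  · simp only [map_mul]
    rw [Matrix.trace_mul_cycle (ρ (S.preHol U)) (ρ g) (ρ (S.sufHol U)), Matrix.trace_mul_comm (ρ g)]
  · have h1 : (ρ (S.preHol U * g⁻¹ * S.sufHol U)).trace.re = (ρ ((S.sufHol U)⁻¹ * (g * (S.preHol U)⁻¹))).trace.re := by
      rw [← Literature.RepresentationTheory.CompactGroups.CompactGroup.re_trace_map_inv ρ hρ (S.preHol U * g⁻¹ * S.sufHol U)]
      congr 3
      group
    rw [h1, show g * (S.sufHol U * S.preHol U)⁻¹ = (g * (S.preHol U)⁻¹) * (S.sufHol U)⁻¹ by group]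
    simp only [map_mul]
    rw [Matrix.trace_mul_comm]

end Split

/-! ## The plaquette word reads its link `(x, μ)` exactly once -/

/-- The links read by the plaquette word `+e_μ +e_ν −e_μ −e_ν` from `y`. [folklore] -/
theorem edgesRead_plaquette (y : A) (μ ν : Fin d) :
    edgesRead e y (Word.plaquette μ ν) = [(y, μ), (y + e μ, ν), (y + e ν, μ), (y, ν)] := by
  have h1 : y + e μ + e ν - e μ = y + e ν := by abel
  have h2 : y + e ν - e ν = y := by abel
  simp [Word.plaquette, edgesRead, Step.link, Step.move, h1, h2]

end Word

end TiltedRP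

end Summit.QuantumFields.GaugeBoot
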